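import Literature.NumberTheory.Automorphic.SymplecticRankOneSatakeClassical
import Literature.NumberTheory.Automorphic.SymplecticGroupCartanUnique
import Literature.NumberTheory.Automorphic.UnitaryRankOneUnramifiedCharacters
import HarnessLib

/-!
# The basic Hecke operator of `ℋ(SL₂(K), SL₂(𝒪))` evaluated: `𝒮_q(1_{K₀tK₀}) = q·(x + x⁻¹) + (q - 1)`, `t = diag(ϖ; ϖ⁻¹)`
# (Cartier §IV (4.2); Macdonald V (3.4); Satake 1963)

Topic `NumberTheory/Automorphic`; namespace `Literature.NumberTheory.Automorphic.SymplecticCartan` (lane `lit-hodgefound`, Track 2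
foundations; seat `lit-hodgefound-p11`, generation 46, row g46-#7).  THEOREMS ONLY: no definition, no named fact, no instance, no
notation.  The `Sp₂ = SL₂` companion of `UnitaryRankOneBasicHeckeOperator` (g46-#6: `U(3)`, `U(2)`), on top of
`SymplecticRankOneSatakeClassical` (g45-#2: `𝒮_q(T)_{-μ} = 𝒮_q(T)_μ`, modulus evaluated), `SymplecticSatakeIsomorphismRankOne`
(g44-#8: support and top coefficient of `𝒮_1(T_{d(k)})`), `SymplecticGroupCartanUnique` (g35-#2: Cartan decomposition) and
`SubgroupIndexDevissage` (g45-#1: `[{v ≤ |ϖ^{-a}|} : {v ≤ |ϖ^{-b}|}] = q^{(a-b)⁺}`).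

## The mathematics

`K` a `ℤᵐ⁰`-valued field with uniformiser `ϖ` and finite residue field `𝓀`, `q = #𝓀`; `G = Sp₂(K) = SL₂(K)` on `K^{inl 0} ⊕ K^{inr 0}`,
`K₀ = Sp₂(𝒪)`, `B(K)` the Borel subgroup of `SymplecticGroupIwasawa` (`(a 0; c d)`), Iwasawa exponent `a(g) = -log v(a)` for
`g = (a 0; c d)·k`, `t = d(1) = diag(ϖ; ϖ⁻¹)` (`a(t) = 1`), and over any commutative ring `R` with a unit `q ∈ Rˣ` EQUAL to the
residue cardinality, Cartier's normalised transform `𝒮_q : ℋ(G, K₀; R) → R[x^{±1}]`, `𝒮_q(T)_m = #{gK₀ ⊆ supp T : a(g) = m} · q^{m}`.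
THE RESULT:

  **`𝒮_q(1_{K₀tK₀}) = q · (x + x⁻¹) + (q - 1) · 1`**  (`symplecticSatakeTransform_doubleCosetOperator_basic`),

i.e. `K₀tK₀/K₀` consists of `1` coset of exponent `1` (weight `q`), `q²` cosets of exponent `-1` (weight `q⁻¹`) and **`q - 1` cosets of
exponent `0`** (`card_filter_symplecticIwasawaExp_basic_zero`) — on the `(q+1)`-regular tree of `SL₂(K)`: the vertices at distance `2`
from the origin, split by the horocycle through it.  THE MIDDLE COUNT: a lower unipotent `u(γ) = (1 0; γ 1)` lies in `K₀tK₀` iff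
`v γ = |ϖ⁻¹|` (the bound `max v(g_{ij})` is a `K₀`-bi-invariant; Cartan), the cosets of exponent `0` are the `u(γ)K₀`, and
`u(γ)K₀ = u(γ')K₀` iff `v(γ - γ') ≤ 1`; so they are the non-zero classes of `ϖ⁻¹𝒪/𝒪`, `[ϖ⁻¹𝒪 : 𝒪] - 1 = q - 1` in number.
CONSEQUENCES: the unramified eigenvalues **`λ_{q,χ}(1_{K₀tK₀}) = q(z + z⁻¹) + q - 1`**, `z = χ(x)`
(`symplecticHeckeEigencharacter_doubleCosetOperator_basic`), and the degree **`#(K₀tK₀/K₀) = q² + q`** (`card_orbit_basic`: the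
eigenvalue at `z = q⁻¹`, where `λ_{q, w_q⁻¹} = λ_{1,1} = deg`).

## What is formalised (theorems only, `n = 1`)

* §1 (any index type `l`) `forall_v_apply_le_of_symplecticInt_mul` / `_of_mul_symplecticInt`,
  `forall_v_apply_le_iff_of_eq_mul_mul_symplectic` (`Sp(J, 𝒪)`-bi-invariance of entry bounds), `forall_v_diagonal_pow_apply_le_iff`
  (entries of `d(a)`).
* §2 lower unipotents of `SL₂`: `fromBlocks_one_zero_of_apply` (entries of `u(γ)`), `coe_eq_fromBlocks_of_lowerUnipotent`,
  `forall_v_apply_le_iff_of_lowerUnipotent`, `mem_symplecticInt_iff_of_lowerUnipotent` (`u(γ) ∈ Sp₂(𝒪) ↔ v γ ≤ 1`),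
  `symplecticIwasawaExp_of_lowerUnipotent` (`a(u) = 0`), **`coe_mem_orbit_basic_iff_symplectic`** (`u(γ) ∈ K₀tK₀ ↔ v γ = |ϖ⁻¹|`).
* §3 **`card_filter_symplecticIwasawaExp_basic_zero`** (`= q - 1`), `coeff_symplecticSatakeTransform_basic_one` / `_neg_one` / `_zero` /
  `_eq_zero`, **`symplecticSatakeTransform_doubleCosetOperator_basic`** (`𝒮_q(1_{K₀tK₀}) = q·(x + x⁻¹) + (q - 1)`).
* §4 **`symplecticHeckeEigencharacter_doubleCosetOperator_basic`** (`λ_{q,χ} = q(χ(x) + χ(x⁻¹)) + q - 1`),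
  `symplecticSatakeWeight_mul_inv_eq_one`, `symplecticSatakeWeight_one`, **`card_orbit_basic_symplectic`** (`#(K₀tK₀/K₀) = q² + q`).
* §5 (rider g46-#7b) `exists_aeval_eq_of_symmetric_fin_one` (**`R[x^{±1}]^W = R[x + x⁻¹]`**), **`exists_generator_symplectic_rank_one`**,
  `doubleCosetOperator_basic_eq_symplectic` (`1_{K₀tK₀} = q T₁ + (q - 1)`), **`exists_aeval_doubleCosetOperator_basic_symplectic`**
  (**`ℋ(SL₂(K), SL₂(𝒪); R) = R[1_{K₀tK₀}]`**), `algHom_ext_doubleCosetOperator_basic_symplectic`.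

## References
* [CartierCorvallis1979] P. Cartier, *Representations of 𝔭-adic groups: a survey*, PSPM 33.1 (1979), §IV (4.2), Thm. 4.1, Cor. 4.2.
* [Macdonald1995] I. G. Macdonald, *Symmetric Functions and Hall Polynomials*, 2nd ed. (1995), Ch. V (2.6), (3.4).
* [Satake1963] I. Satake, Publ. Math. IHÉS 18 (1963), §§6–7.
* [BruhatTits1972] F. Bruhat, J. Tits, Publ. Math. IHÉS 41 (1972), (4.4.3)–(4.4.4).
* [AndrianovZhuravlev1995] A. N. Andrianov, V. G. Zhuravlev, *Modular Forms and Hecke Operators* (1995), Ch. 3 §3, Lemma 3.6.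
* [Serre1979] J.-P. Serre, *Local Fields*, GTM 67 (1979), Ch. II §3.
-/

noncomputable section

open scoped Valued WithZero Pointwise
open Matrix MonoidAlgebra Representation Finset MulAction ConjAct Polynomial

namespace Literature.NumberTheory.Automorphic.SymplecticCartan

open Literature.NumberTheory.Automorphic.CartanUnique Literature.NumberTheory.Automorphic.HermitianLattice

variable {K : Type*} [Field K] [Valued K ℤᵐ⁰] {ϖ : K}

/-! ## §1 Entry bounds are `Sp(J, 𝒪)`-bi-invariant -/

section Bounds

variable {l : Type*} [Fintype l] [DecidableEq l]

/-- Left multiplication by `k ∈ Sp(J, 𝒪)` preserves the bound `v(g_{ij}) ≤ γ`. [cite: AndrianovZhuravlev1995, Ch. 3 §3 Lemma 3.6] -/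
theorem forall_v_apply_le_of_symplecticInt_mul {k : symplecticGroup l K} (hk : k ∈ symplecticInt l K) {g : symplecticGroup l K} {γ : ℤᵐ⁰}
    (hg : ∀ i j, Valued.v ((g : Matrix (l ⊕ l) (l ⊕ l) K) i j) ≤ γ) (i j : l ⊕ l) :
    Valued.v (((k * g : symplecticGroup l K) : Matrix (l ⊕ l) (l ⊕ l) K) i j) ≤ γ := by
  have hk' := mem_symplecticInt_iff.1 hk
  rw [Submonoid.coe_mul, Matrix.mul_apply]
  refine Valuation.map_sum_le _ fun m _ => ?_
  rw [map_mul]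
  calc Valued.v ((k : Matrix (l ⊕ l) (l ⊕ l) K) i m) * Valued.v ((g : Matrix (l ⊕ l) (l ⊕ l) K) m j) ≤ 1 * γ := mul_le_mul' (hk' i m) (hg m j)
    _ = γ := one_mul γ

/-- Right multiplication by `k ∈ Sp(J, 𝒪)` preserves the bound `v(g_{ij}) ≤ γ`. [cite: AndrianovZhuravlev1995, Ch. 3 §3 Lemma 3.6] -/
theorem forall_v_apply_le_of_mul_symplecticInt {k : symplecticGroup l K} (hk : k ∈ symplecticInt l K) {g : symplecticGroup l K} {γ : ℤᵐ⁰}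
    (hg : ∀ i j, Valued.v ((g : Matrix (l ⊕ l) (l ⊕ l) K) i j) ≤ γ) (i j : l ⊕ l) :
    Valued.v (((g * k : symplecticGroup l K) : Matrix (l ⊕ l) (l ⊕ l) K) i j) ≤ γ := by
  have hk' := mem_symplecticInt_iff.1 hk
  rw [Submonoid.coe_mul, Matrix.mul_apply]
  refine Valuation.map_sum_le _ fun m _ => ?_
  rw [map_mul]
  calc Valued.v ((g : Matrix (l ⊕ l) (l ⊕ l) K) i m) * Valued.v ((k : Matrix (l ⊕ l) (l ⊕ l) K) m j) ≤ γ * 1 := mul_le_mul' (hg i m) (hk' m j)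
    _ = γ := mul_one γ

/-- **Entry bounds are constant on `Sp(J, 𝒪)`-double cosets**: if `g' = a g b` with `a, b ∈ Sp(J, 𝒪)`, all entries of `g'` have
`v ≤ γ` iff all entries of `g` do. [cite: AndrianovZhuravlev1995, Ch. 3 §3 Lemma 3.6] [cite: BruhatTits1972, (4.4.3)] -/
theorem forall_v_apply_le_iff_of_eq_mul_mul_symplectic {a b g g' : symplecticGroup l K} (ha : a ∈ symplecticInt l K)
    (hb : b ∈ symplecticInt l K) (h : g' = a * g * b) (γ : ℤᵐ⁰) :
    (∀ i j, Valued.v ((g' : Matrix (l ⊕ l) (l ⊕ l) K) i j) ≤ γ) ↔ ∀ i j, Valued.v ((g : Matrix (l ⊕ l) (l ⊕ l) K) i j) ≤ γ := by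
  constructor
  · intro hg'
    have hg : g = a⁻¹ * g' * b⁻¹ := by rw [h]; group
    rw [hg]
    exact forall_v_apply_le_of_mul_symplecticInt ((symplecticInt l K).inv_mem hb)
      (forall_v_apply_le_of_symplecticInt_mul ((symplecticInt l K).inv_mem ha) hg')
  · intro hg
    rw [h]
    exact forall_v_apply_le_of_mul_symplecticInt hb (forall_v_apply_le_of_symplecticInt_mul ha hg)

omit [Fintype l] in
/-- The entries of `d(a) = diag(ϖ^{a_i}; ϖ^{-a_i})` (`a ∈ ℕ^l`) have `v ≤ |ϖ^{-γ}|` iff `a_i ≤ γ` for all `i` (for `γ ≥ 0`).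
[cite: AndrianovZhuravlev1995, Ch. 3 §3 Lemma 3.6] -/
theorem forall_v_diagonal_pow_apply_le_iff (hϖ : Valued.v ϖ = WithZero.exp (-1 : ℤ)) (a : l → ℕ) {γ : ℤ} (hγ : 0 ≤ γ) :
    (∀ i j, Valued.v ((Matrix.diagonal (Sum.elim (fun i => ϖ ^ a i) (fun i => (ϖ ^ a i)⁻¹)) : Matrix (l ⊕ l) (l ⊕ l) K) i j) ≤ WithZero.exp γ) ↔
      ∀ i, (a i : ℤ) ≤ γ := by
  have hv : ∀ i, Valued.v ((ϖ ^ a i)⁻¹) = WithZero.exp (a i : ℤ) := fun i => by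
    rw [map_inv₀, map_pow, hϖ, ← WithZero.exp_nsmul, ← WithZero.exp_neg]; congr 1; simp
  have hv' : ∀ i, Valued.v (ϖ ^ a i) = WithZero.exp (-(a i : ℤ)) := fun i => by
    rw [map_pow, hϖ, ← WithZero.exp_nsmul]; congr 1; simp
  constructor
  · intro h i
    have := h (Sum.inr i) (Sum.inr i)
    rwa [Matrix.diagonal_apply_eq, Sum.elim_inr, hv, WithZero.exp_le_exp] at this
  · intro h i j
    by_cases hij : i = j
    · subst hij
      rw [Matrix.diagonal_apply_eq]
      rcases i with i | i
      · rw [Sum.elim_inl, hv', WithZero.exp_le_exp]; have := h i; omega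
      · rw [Sum.elim_inr, hv, WithZero.exp_le_exp]; exact h i
    · rw [Matrix.diagonal_apply_ne _ hij, map_zero]; exact zero_le

end Bounds

/-! ## §2 Lower unipotents `u = (1 0; γ 1)` of `SL₂`: double coset and Iwasawa exponent -/

section RankOne

variable {R : Type*} [CommRing R] (hϖ : Valued.v ϖ = WithZero.exp (-1 : ℤ))

omit [Valued K ℤᵐ⁰] in
/-- The explicit lower unipotent `u(γ) = (1 0; γ 1) ∈ Sp₂(K)`: its entries. [cite: Macdonald1995, Ch. V (2.6)] -/
theorem fromBlocks_one_zero_of_apply (γ : K) :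
    (Matrix.fromBlocks (1 : Matrix (Fin 1) (Fin 1) K) 0 (Matrix.of fun _ _ => γ) (1 : Matrix (Fin 1) (Fin 1) K)) (Sum.inl 0) (Sum.inl 0) = 1 ∧
      (Matrix.fromBlocks (1 : Matrix (Fin 1) (Fin 1) K) 0 (Matrix.of fun _ _ => γ) (1 : Matrix (Fin 1) (Fin 1) K)) (Sum.inl 0) (Sum.inr 0) = 0 ∧
        (Matrix.fromBlocks (1 : Matrix (Fin 1) (Fin 1) K) 0 (Matrix.of fun _ _ => γ) (1 : Matrix (Fin 1) (Fin 1) K)) (Sum.inr 0) (Sum.inl 0) = γ ∧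
          (Matrix.fromBlocks (1 : Matrix (Fin 1) (Fin 1) K) 0 (Matrix.of fun _ _ => γ) (1 : Matrix (Fin 1) (Fin 1) K)) (Sum.inr 0) (Sum.inr 0) = 1 := by
  refine ⟨?_, ?_, ?_, ?_⟩
  · rw [Matrix.fromBlocks_apply₁₁, Matrix.one_apply_eq]
  · rw [Matrix.fromBlocks_apply₁₂, Matrix.zero_apply]
  · rw [Matrix.fromBlocks_apply₂₁, Matrix.of_apply]
  · rw [Matrix.fromBlocks_apply₂₂, Matrix.one_apply_eq]

omit [Valued K ℤᵐ⁰] in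
/-- A lower unipotent `u ∈ SL₂` (`u_{inl,inl} = u_{inr,inr} = 1`, `u_{inl,inr} = 0`) IS `u(γ)`, `γ = u_{inr,inl}`.
[cite: Macdonald1995, Ch. V (2.6)] -/
theorem coe_eq_fromBlocks_of_lowerUnipotent {u : symplecticGroup (Fin 1) K}
    (h11 : (u : Matrix (Fin 1 ⊕ Fin 1) (Fin 1 ⊕ Fin 1) K) (Sum.inl 0) (Sum.inl 0) = 1)
    (h12 : (u : Matrix (Fin 1 ⊕ Fin 1) (Fin 1 ⊕ Fin 1) K) (Sum.inl 0) (Sum.inr 0) = 0)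
    (h22 : (u : Matrix (Fin 1 ⊕ Fin 1) (Fin 1 ⊕ Fin 1) K) (Sum.inr 0) (Sum.inr 0) = 1) :
    (u : Matrix (Fin 1 ⊕ Fin 1) (Fin 1 ⊕ Fin 1) K) =
      Matrix.fromBlocks (1 : Matrix (Fin 1) (Fin 1) K) 0 (Matrix.of fun _ _ => (u : Matrix (Fin 1 ⊕ Fin 1) (Fin 1 ⊕ Fin 1) K) (Sum.inr 0) (Sum.inl 0))
        (1 : Matrix (Fin 1) (Fin 1) K) := by
  obtain ⟨e11, e12, e21, e22⟩ := fromBlocks_one_zero_of_apply (K := K) ((u : Matrix (Fin 1 ⊕ Fin 1) (Fin 1 ⊕ Fin 1) K) (Sum.inr 0) (Sum.inl 0))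
  ext i j
  rcases i with i | i <;> rcases j with j | j <;> rw [Subsingleton.elim i 0, Subsingleton.elim j 0]
  · rw [h11, e11]
  · rw [h12, e12]
  · rw [e21]
  · rw [h22, e22]

/-- The entries of a lower unipotent `u(γ)` have `v ≤ |ϖ^{-δ}|` (`δ ≥ 0`) iff `v γ ≤ |ϖ^{-δ}|`. [cite: Macdonald1995, Ch. V (2.6)] -/
theorem forall_v_apply_le_iff_of_lowerUnipotent {u : symplecticGroup (Fin 1) K}
    (h11 : (u : Matrix (Fin 1 ⊕ Fin 1) (Fin 1 ⊕ Fin 1) K) (Sum.inl 0) (Sum.inl 0) = 1)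
    (h12 : (u : Matrix (Fin 1 ⊕ Fin 1) (Fin 1 ⊕ Fin 1) K) (Sum.inl 0) (Sum.inr 0) = 0)
    (h22 : (u : Matrix (Fin 1 ⊕ Fin 1) (Fin 1 ⊕ Fin 1) K) (Sum.inr 0) (Sum.inr 0) = 1) {δ : ℤ} (hδ : 0 ≤ δ) :
    (∀ i j, Valued.v ((u : Matrix (Fin 1 ⊕ Fin 1) (Fin 1 ⊕ Fin 1) K) i j) ≤ WithZero.exp δ) ↔
      Valued.v ((u : Matrix (Fin 1 ⊕ Fin 1) (Fin 1 ⊕ Fin 1) K) (Sum.inr 0) (Sum.inl 0)) ≤ WithZero.exp δ := by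
  have h1 : (1 : ℤᵐ⁰) ≤ WithZero.exp δ := by rw [← WithZero.exp_zero, WithZero.exp_le_exp]; exact hδ
  refine ⟨fun h => h _ _, fun h i j => ?_⟩
  rcases i with i | i <;> rcases j with j | j <;> rw [Subsingleton.elim i 0, Subsingleton.elim j 0]
  · rw [h11, map_one]; exact h1
  · rw [h12, map_zero]; exact zero_le
  · exact h
  · rw [h22, map_one]; exact h1

/-- A lower unipotent `u(γ)` lies in `Sp₂(𝒪)` iff `v γ ≤ 1`. [cite: AndrianovZhuravlev1995, Ch. 3 §3 Lemma 3.4] -/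
theorem mem_symplecticInt_iff_of_lowerUnipotent {u : symplecticGroup (Fin 1) K}
    (h11 : (u : Matrix (Fin 1 ⊕ Fin 1) (Fin 1 ⊕ Fin 1) K) (Sum.inl 0) (Sum.inl 0) = 1)
    (h12 : (u : Matrix (Fin 1 ⊕ Fin 1) (Fin 1 ⊕ Fin 1) K) (Sum.inl 0) (Sum.inr 0) = 0)
    (h22 : (u : Matrix (Fin 1 ⊕ Fin 1) (Fin 1 ⊕ Fin 1) K) (Sum.inr 0) (Sum.inr 0) = 1) :
    u ∈ symplecticInt (Fin 1) K ↔ Valued.v ((u : Matrix (Fin 1 ⊕ Fin 1) (Fin 1 ⊕ Fin 1) K) (Sum.inr 0) (Sum.inl 0)) ≤ 1 := by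
  rw [mem_symplecticInt_iff, ← WithZero.exp_zero]
  exact forall_v_apply_le_iff_of_lowerUnipotent h11 h12 h22 le_rfl

include hϖ in
/-- A lower unipotent has Iwasawa exponent `a(u) = 0` (`u ∈ B(K)` with unit diagonal). [cite: CartierCorvallis1979, §IV (4.2)] -/
theorem symplecticIwasawaExp_of_lowerUnipotent {u : symplecticGroup (Fin 1) K}
    (h11 : (u : Matrix (Fin 1 ⊕ Fin 1) (Fin 1 ⊕ Fin 1) K) (Sum.inl 0) (Sum.inl 0) = 1)
    (h12 : (u : Matrix (Fin 1 ⊕ Fin 1) (Fin 1 ⊕ Fin 1) K) (Sum.inl 0) (Sum.inr 0) = 0) :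
    symplecticIwasawaExp hϖ u = 0 := by
  funext i
  rw [Subsingleton.elim i 0, symplecticIwasawaExp_of_mem_symplecticBorel hϖ (mem_symplecticBorel_iff_rank_one.2 h12) 0, h11, map_one,
    Pi.zero_apply, ← WithZero.exp_zero, WithZero.log_exp, neg_zero]

include hϖ in
/-- **The double coset of a lower unipotent**: `u(γ) ∈ K₀ t K₀`, `t = d(1) = diag(ϖ; ϖ⁻¹)`, iff `v γ = |ϖ⁻¹|` (the bound
`max v(g_{ij})` is a double-coset invariant and equals `|ϖ^{-a}|` on `K₀ d(a) K₀`). [cite: AndrianovZhuravlev1995, Ch. 3 §3 Lemma 3.6]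
[cite: BruhatTits1972, (4.4.3)] -/
theorem coe_mem_orbit_basic_iff_symplectic {u : symplecticGroup (Fin 1) K}
    (h11 : (u : Matrix (Fin 1 ⊕ Fin 1) (Fin 1 ⊕ Fin 1) K) (Sum.inl 0) (Sum.inl 0) = 1)
    (h12 : (u : Matrix (Fin 1 ⊕ Fin 1) (Fin 1 ⊕ Fin 1) K) (Sum.inl 0) (Sum.inr 0) = 0)
    (h22 : (u : Matrix (Fin 1 ⊕ Fin 1) (Fin 1 ⊕ Fin 1) K) (Sum.inr 0) (Sum.inr 0) = 1) :
    (u : symplecticGroup (Fin 1) K ⧸ symplecticInt (Fin 1) K) ∈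
        MulAction.orbit (symplecticInt (Fin 1) K)
          ((⟨Matrix.diagonal (Sum.elim (fun _ : Fin 1 => ϖ ^ (1 : ℕ)) (fun _ : Fin 1 => (ϖ ^ (1 : ℕ))⁻¹)),
              diagonal_pow_mem_symplecticGroup (uniformizer_ne_zero hϖ) (fun _ : Fin 1 => 1)⟩ : symplecticGroup (Fin 1) K) :
            symplecticGroup (Fin 1) K ⧸ symplecticInt (Fin 1) K) ↔
      Valued.v ((u : Matrix (Fin 1 ⊕ Fin 1) (Fin 1 ⊕ Fin 1) K) (Sum.inr 0) (Sum.inl 0)) ≤ WithZero.exp 1 ∧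
        ¬ Valued.v ((u : Matrix (Fin 1 ⊕ Fin 1) (Fin 1 ⊕ Fin 1) K) (Sum.inr 0) (Sum.inl 0)) ≤ 1 := by
  have hϖ0 := uniformizer_ne_zero hϖ
  have h01 : (0 : ℤ) ≤ 1 := zero_le_one
  constructor
  · intro hmem
    obtain ⟨a, ha, b, hb, hab⟩ := (heckeAlgebra.coe_mem_orbit_coe_iff (symplecticInt (Fin 1) K) _ u).1 hmem
    have key : ∀ δ : ℤ, 0 ≤ δ →
        (Valued.v ((u : Matrix (Fin 1 ⊕ Fin 1) (Fin 1 ⊕ Fin 1) K) (Sum.inr 0) (Sum.inl 0)) ≤ WithZero.exp δ ↔ ∀ _i : Fin 1, ((1 : ℕ) : ℤ) ≤ δ) :=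
      fun δ hδ => by
        rw [← forall_v_apply_le_iff_of_lowerUnipotent h11 h12 h22 hδ, forall_v_apply_le_iff_of_eq_mul_mul_symplectic ha hb hab,
          ← forall_v_diagonal_pow_apply_le_iff hϖ (fun _ : Fin 1 => 1) hδ]
    have h1 := (key 1 h01).2 fun _ => le_rfl
    have h0 : ¬ Valued.v ((u : Matrix (Fin 1 ⊕ Fin 1) (Fin 1 ⊕ Fin 1) K) (Sum.inr 0) (Sum.inl 0)) ≤ 1 := fun h => by
      have := (key 0 le_rfl).1 (by rw [WithZero.exp_zero]; exact h) 0
      simp at this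
    exact ⟨h1, h0⟩
  · rintro ⟨hγ, hγ'⟩
    obtain ⟨k₁, k₂, a, hk₁, hk₂, -, hD⟩ := exists_cartan_decomposition_antitone hϖ u
    have key : ∀ δ : ℤ, 0 ≤ δ →
        (Valued.v ((u : Matrix (Fin 1 ⊕ Fin 1) (Fin 1 ⊕ Fin 1) K) (Sum.inr 0) (Sum.inl 0)) ≤ WithZero.exp δ ↔ ∀ i : Fin 1, (a i : ℤ) ≤ δ) :=
      fun δ hδ => by
        rw [← forall_v_apply_le_iff_of_lowerUnipotent h11 h12 h22 hδ, ← forall_v_apply_le_iff_of_eq_mul_mul_symplectic hk₁ hk₂ rfl, hD,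
          forall_v_diagonal_pow_apply_le_iff hϖ a hδ]
    have h1 : (a 0 : ℤ) ≤ 1 := (key 1 h01).1 hγ 0
    have h0 : ¬ (a 0 : ℤ) ≤ 0 := fun h => hγ' (by
      have := (key 0 le_rfl).2 (fun i => by rw [Subsingleton.elim i 0]; exact h)
      rwa [WithZero.exp_zero] at this)
    have ha : a = fun _ : Fin 1 => 1 := funext fun i => by rw [Subsingleton.elim i 0]; omega
    subst ha
    have hut : k₁ * u * k₂ = (⟨Matrix.diagonal (Sum.elim (fun _ : Fin 1 => ϖ ^ (1 : ℕ)) (fun _ : Fin 1 => (ϖ ^ (1 : ℕ))⁻¹)),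
        diagonal_pow_mem_symplecticGroup hϖ0 (fun _ : Fin 1 => 1)⟩ : symplecticGroup (Fin 1) K) := Subtype.ext hD
    refine (heckeAlgebra.coe_mem_orbit_coe_iff (symplecticInt (Fin 1) K) _ u).2
      ⟨k₁⁻¹, (symplecticInt (Fin 1) K).inv_mem hk₁, k₂⁻¹, (symplecticInt (Fin 1) K).inv_mem hk₂, ?_⟩
    rw [← hut]; group

/-! ## §3 The middle coefficient `#{gK₀ ⊆ K₀tK₀ : a(g) = 0} = q - 1` and `𝒮_q(1_{K₀tK₀})` -/

include hϖ in
/-- **THE MIDDLE COEFFICIENT**: the left cosets `gK₀ ⊆ K₀ t K₀` (`t = diag(ϖ; ϖ⁻¹)`) of Iwasawa exponent `0` number `q - 1`: they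
are the `u(γ)K₀`, `v γ = |ϖ⁻¹|`, modulo `𝒪` — the non-zero classes of `ϖ⁻¹𝒪/𝒪`. [cite: CartierCorvallis1979, §IV (4.2)]
[cite: Macdonald1995, Ch. V (2.6)] [cite: Serre1979, Ch. II §3] -/
theorem card_filter_symplecticIwasawaExp_basic_zero [Finite 𝓀[K]]
    [IsHeckeTriple (⊤ : Submonoid (symplecticGroup (Fin 1) K)) (symplecticInt (Fin 1) K) (symplecticInt (Fin 1) K)]
    [DecidablePred fun α : symplecticGroup (Fin 1) K ⧸ symplecticInt (Fin 1) K => symplecticIwasawaExp hϖ α.out = (0 : Fin 1 → ℤ)] :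
    ((finite_orbit_quotient (symplecticInt (Fin 1) K)
        (⟨Matrix.diagonal (Sum.elim (fun _ : Fin 1 => ϖ ^ (1 : ℕ)) (fun _ : Fin 1 => (ϖ ^ (1 : ℕ))⁻¹)),
            diagonal_pow_mem_symplecticGroup (uniformizer_ne_zero hϖ) (fun _ : Fin 1 => 1)⟩ : symplecticGroup (Fin 1) K)).toFinset.filter
        fun α => symplecticIwasawaExp hϖ α.out = (0 : Fin 1 → ℤ)).card = Nat.card 𝓀[K] - 1 := by
  classical
  have hϖ0 := uniformizer_ne_zero hϖ
  set t : symplecticGroup (Fin 1) K := ⟨Matrix.diagonal (Sum.elim (fun _ : Fin 1 => ϖ ^ (1 : ℕ)) (fun _ : Fin 1 => (ϖ ^ (1 : ℕ))⁻¹)),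
    diagonal_pow_mem_symplecticGroup (uniformizer_ne_zero hϖ) (fun _ : Fin 1 => 1)⟩ with ht
  set S := ((finite_orbit_quotient (symplecticInt (Fin 1) K) t).toFinset.filter
    fun α => symplecticIwasawaExp hϖ α.out = (0 : Fin 1 → ℤ)) with hS
  have hmemS : ∀ α, α ∈ S ↔ α ∈ MulAction.orbit (symplecticInt (Fin 1) K) (t : symplecticGroup (Fin 1) K ⧸ symplecticInt (Fin 1) K) ∧
      symplecticIwasawaExp hϖ α.out = 0 := fun α => by
    rw [hS, Finset.mem_filter, Set.Finite.mem_toFinset]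
  -- the balls `ϖ⁻¹𝒪 ⊇ 𝒪`
  set L1 : AddSubgroup K := (Valued.v : Valuation K ℤᵐ⁰).leAddSubgroup (WithZero.exp (1 : ℤ)) with hL1
  set L0 : AddSubgroup K := (Valued.v : Valuation K ℤᵐ⁰).leAddSubgroup (WithZero.exp (0 : ℤ)) with hL0
  have hmemL1 : ∀ β : K, β ∈ L1 ↔ Valued.v β ≤ WithZero.exp 1 := fun β => by rw [hL1, Valuation.mem_leAddSubgroup_iff]
  have hmemL0 : ∀ β : K, β ∈ L0 ↔ Valued.v β ≤ 1 := fun β => by rw [hL0, Valuation.mem_leAddSubgroup_iff, WithZero.exp_zero]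
  have hidx : L0.relIndex L1 = Nat.card 𝓀[K] := by
    rw [hL0, hL1, relIndex_leAddSubgroup_exp hϖ 1 0]; simp
  -- the lower unipotents `u(γ)`
  obtain ⟨u, hu⟩ : ∃ u : K → symplecticGroup (Fin 1) K, ∀ γ, (u γ : Matrix (Fin 1 ⊕ Fin 1) (Fin 1 ⊕ Fin 1) K) =
      Matrix.fromBlocks (1 : Matrix (Fin 1) (Fin 1) K) 0 (Matrix.of fun _ _ => γ) (1 : Matrix (Fin 1) (Fin 1) K) :=
    ⟨fun γ => ⟨_, fromBlocks_one_zero_mem_symplecticGroup (Matrix.IsSymm.ext fun _ _ => rfl)⟩, fun γ => rfl⟩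
  have hu11 : ∀ γ, (u γ : Matrix (Fin 1 ⊕ Fin 1) (Fin 1 ⊕ Fin 1) K) (Sum.inl 0) (Sum.inl 0) = 1 := fun γ => by
    rw [hu]; exact (fromBlocks_one_zero_of_apply γ).1
  have hu12 : ∀ γ, (u γ : Matrix (Fin 1 ⊕ Fin 1) (Fin 1 ⊕ Fin 1) K) (Sum.inl 0) (Sum.inr 0) = 0 := fun γ => by
    rw [hu]; exact (fromBlocks_one_zero_of_apply γ).2.1
  have hu21 : ∀ γ, (u γ : Matrix (Fin 1 ⊕ Fin 1) (Fin 1 ⊕ Fin 1) K) (Sum.inr 0) (Sum.inl 0) = γ := fun γ => by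
    rw [hu]; exact (fromBlocks_one_zero_of_apply γ).2.2.1
  have hu22 : ∀ γ, (u γ : Matrix (Fin 1 ⊕ Fin 1) (Fin 1 ⊕ Fin 1) K) (Sum.inr 0) (Sum.inr 0) = 1 := fun γ => by
    rw [hu]; exact (fromBlocks_one_zero_of_apply γ).2.2.2
  have humul : ∀ γ γ', u γ * u γ' = u (γ + γ') := fun γ γ' => by
    refine Subtype.ext ?_
    rw [Submonoid.coe_mul, hu, hu, hu, fromBlocks_one_zero_mul_fromBlocks_one_zero]
    congr 1
  have hu0 : u 0 = 1 := by
    refine Subtype.ext ?_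
    rw [hu, show (Matrix.of fun (_ : Fin 1) (_ : Fin 1) => (0 : K)) = 0 from by ext i j; rfl, Matrix.fromBlocks_one]
    rfl
  have hau : ∀ γ, symplecticIwasawaExp hϖ (u γ) = 0 := fun γ => symplecticIwasawaExp_of_lowerUnipotent hϖ (hu11 γ) (hu12 γ)
  -- (F1) fibres
  have hF1 : ∀ γ γ' : K, ((u γ : symplecticGroup (Fin 1) K) : symplecticGroup (Fin 1) K ⧸ symplecticInt (Fin 1) K) = (u γ' : _) ↔
      Valued.v (γ' - γ) ≤ 1 := fun γ γ' => by
    rw [QuotientGroup.eq, show u γ' = u γ * u (γ' - γ) by rw [humul, add_sub_cancel], inv_mul_cancel_left,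
      mem_symplecticInt_iff_of_lowerUnipotent (hu11 _) (hu12 _) (hu22 _), hu21]
  -- (F2)
  have hF2 : ∀ β : L1, ((u β : symplecticGroup (Fin 1) K) : symplecticGroup (Fin 1) K ⧸ symplecticInt (Fin 1) K) ∈ S ↔
      ¬ Valued.v (β : K) ≤ 1 := fun β => by
    rw [hmemS, ht, coe_mem_orbit_basic_iff_symplectic hϖ (hu11 _) (hu12 _) (hu22 _), hu21]
    obtain ⟨k, hk⟩ := QuotientGroup.mk_out_eq_mul (symplecticInt (Fin 1) K) (u β)
    rw [hk, symplecticIwasawaExp_mul_of_mem_symplecticInt hϖ _ k.2, hau]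
    exact ⟨fun h => h.1.2, fun h => ⟨⟨(hmemL1 β).1 β.2, h⟩, rfl⟩⟩
  -- (F3)
  have hF3 : ∀ α ∈ S, ∃ β : L1, ((u β : symplecticGroup (Fin 1) K) : symplecticGroup (Fin 1) K ⧸ symplecticInt (Fin 1) K) = α := by
    intro α hα
    obtain ⟨horb, ha0⟩ := (hmemS α).1 hα
    obtain ⟨p, hp, k, hk, hgpk⟩ := (isIwasawaExponent_symplectic (n := 1) hϖ).exists_eq_mul α.out
    have hap : symplecticIwasawaExp hϖ p = 0 := by rw [← ha0, hgpk, symplecticIwasawaExp_mul_of_mem_symplecticInt hϖ _ hk]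
    have hb : (p : Matrix (Fin 1 ⊕ Fin 1) (Fin 1 ⊕ Fin 1) K) (Sum.inl 0) (Sum.inr 0) = 0 := mem_symplecticBorel_iff_rank_one.1 hp
    have hdet := sub_eq_one_of_mem_symplecticGroup_rank_one p
    rw [hb, zero_mul, sub_zero] at hdet
    have ha0' : (p : Matrix (Fin 1 ⊕ Fin 1) (Fin 1 ⊕ Fin 1) K) (Sum.inl 0) (Sum.inl 0) ≠ 0 := fun h => by
      rw [h, zero_mul] at hdet; exact zero_ne_one hdet
    have hva : Valued.v ((p : Matrix (Fin 1 ⊕ Fin 1) (Fin 1 ⊕ Fin 1) K) (Sum.inl 0) (Sum.inl 0)) = 1 := by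
      have h0 := congrFun hap 0
      rw [symplecticIwasawaExp_of_mem_symplecticBorel hϖ hp 0, Pi.zero_apply, neg_eq_zero] at h0
      have hvne : Valued.v ((p : Matrix (Fin 1 ⊕ Fin 1) (Fin 1 ⊕ Fin 1) K) (Sum.inl 0) (Sum.inl 0)) ≠ 0 :=
        (Valuation.ne_zero_iff _).2 ha0'
      obtain ⟨e, he⟩ : ∃ e : ℤ, Valued.v ((p : Matrix (Fin 1 ⊕ Fin 1) (Fin 1 ⊕ Fin 1) K) (Sum.inl 0) (Sum.inl 0)) = WithZero.exp e :=
        ⟨_, (WithZero.exp_log hvne).symm⟩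
      rw [he, WithZero.log_exp] at h0
      rw [he, h0, WithZero.exp_zero]
    have hvd : Valued.v ((p : Matrix (Fin 1 ⊕ Fin 1) (Fin 1 ⊕ Fin 1) K) (Sum.inr 0) (Sum.inr 0)) = 1 := by
      have := congrArg Valued.v hdet
      rwa [map_mul, map_one, hva, one_mul] at this
    have hpα : ((p : symplecticGroup (Fin 1) K) : symplecticGroup (Fin 1) K ⧸ symplecticInt (Fin 1) K) = α := by
      rw [← QuotientGroup.out_eq' α, QuotientGroup.eq, hgpk, inv_mul_cancel_left]
      exact hk
    -- `p = u(γ) · diag(a, d)` with `γ = c / a`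
    set γ : K := (p : Matrix (Fin 1 ⊕ Fin 1) (Fin 1 ⊕ Fin 1) K) (Sum.inr 0) (Sum.inl 0) /
      (p : Matrix (Fin 1 ⊕ Fin 1) (Fin 1 ⊕ Fin 1) K) (Sum.inl 0) (Sum.inl 0) with hγ
    have hp' : u (-γ) * p ∈ symplecticInt (Fin 1) K := by
      rw [mem_symplecticInt_iff]
      have e : ∀ i j, ((u (-γ) * p : symplecticGroup (Fin 1) K) : Matrix (Fin 1 ⊕ Fin 1) (Fin 1 ⊕ Fin 1) K) i j =
          (u (-γ) : Matrix (Fin 1 ⊕ Fin 1) (Fin 1 ⊕ Fin 1) K) i (Sum.inl 0) * (p : Matrix (Fin 1 ⊕ Fin 1) (Fin 1 ⊕ Fin 1) K) (Sum.inl 0) j +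
            (u (-γ) : Matrix (Fin 1 ⊕ Fin 1) (Fin 1 ⊕ Fin 1) K) i (Sum.inr 0) * (p : Matrix (Fin 1 ⊕ Fin 1) (Fin 1 ⊕ Fin 1) K) (Sum.inr 0) j :=
        fun i j => by rw [Submonoid.coe_mul, Matrix.mul_apply, Fintype.sum_sum_type, Fin.sum_univ_one, Fin.sum_univ_one]
      rintro (i | i) (j | j) <;> rw [Subsingleton.elim i 0, Subsingleton.elim j 0, e]
      · rw [hu11, hu12, one_mul, zero_mul, add_zero, hva]
      · rw [hu11, hu12, hb, mul_zero, zero_mul, add_zero, map_zero]; exact zero_le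
      · rw [hu21, hu22, one_mul, hγ, show -( _ / _) * _ + _ = (0 : K) from by field_simp; ring, map_zero]; exact zero_le
      · rw [hu21, hu22, hb, mul_zero, zero_add, one_mul, hvd]
    have hpeq : p = u γ * (u (-γ) * p) := by rw [← mul_assoc, humul, add_neg_cancel, hu0, one_mul]
    have huγ : ((u γ : symplecticGroup (Fin 1) K) : symplecticGroup (Fin 1) K ⧸ symplecticInt (Fin 1) K) = α := by
      rw [← hpα, QuotientGroup.eq, hpeq, inv_mul_cancel_left]; exact hp'
    have hγ1 : Valued.v γ ≤ WithZero.exp 1 := by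
      have h := horb
      rw [← huγ, ht, coe_mem_orbit_basic_iff_symplectic hϖ (hu11 _) (hu12 _) (hu22 _), hu21] at h
      exact h.1
    exact ⟨⟨γ, (hmemL1 γ).2 hγ1⟩, huγ⟩
  -- (F4) counting through `ϖ⁻¹𝒪/𝒪`
  set L0' : AddSubgroup L1 := L0.addSubgroupOf L1 with hL0'
  have hne : Nat.card 𝓀[K] ≠ 0 := Nat.card_pos.ne'
  haveI hfin : Fintype (L1 ⧸ L0') := AddSubgroup.fintypeOfIndexNeZero (by
    show L0.relIndex L1 ≠ 0
    rw [hidx]; exact hne)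
  let F : L1 ⧸ L0' → symplecticGroup (Fin 1) K ⧸ symplecticInt (Fin 1) K :=
    Quotient.lift (s := QuotientAddGroup.leftRel L0')
      (fun β : L1 => ((u β : symplecticGroup (Fin 1) K) : symplecticGroup (Fin 1) K ⧸ symplecticInt (Fin 1) K)) fun β β' h => by
      have h' : -β + β' ∈ L0' := QuotientAddGroup.leftRel_apply.mp h
      rw [hL0', AddSubgroup.mem_addSubgroupOf, hmemL0] at h'
      show ((u β : symplecticGroup (Fin 1) K) : symplecticGroup (Fin 1) K ⧸ symplecticInt (Fin 1) K) = (u β' : _)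
      rw [hF1]
      have hc : ((-β + β' : L1) : K) = (β' : K) - β := by rw [AddSubgroup.coe_add, AddSubgroup.coe_neg]; ring
      rw [← hc]; exact h'
  have hFmk : ∀ β : L1, F (β : L1 ⧸ L0') = ((u β : symplecticGroup (Fin 1) K) : symplecticGroup (Fin 1) K ⧸ symplecticInt (Fin 1) K) :=
    fun β => rfl
  have hFinj : Function.Injective F := by
    intro x y hxy
    obtain ⟨β, rfl⟩ := QuotientAddGroup.mk_surjective x
    obtain ⟨β', rfl⟩ := QuotientAddGroup.mk_surjective y
    rw [hFmk, hFmk, hF1] at hxy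
    refine QuotientAddGroup.eq.2 ?_
    rw [hL0', AddSubgroup.mem_addSubgroupOf, hmemL0]
    have hc : ((-β + β' : L1) : K) = (β' : K) - β := by rw [AddSubgroup.coe_add, AddSubgroup.coe_neg]; ring
    rw [hc]
    exact hxy
  have hnot : ((u ((0 : L1) : K) : symplecticGroup (Fin 1) K) : symplecticGroup (Fin 1) K ⧸ symplecticInt (Fin 1) K) ∉ S := fun h =>
    (hF2 0).1 h (by rw [ZeroMemClass.coe_zero, map_zero]; exact zero_le)
  have himage : Finset.univ.image F =
      insert ((u ((0 : L1) : K) : symplecticGroup (Fin 1) K) : symplecticGroup (Fin 1) K ⧸ symplecticInt (Fin 1) K) S := by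
    ext α
    rw [Finset.mem_image, Finset.mem_insert]
    constructor
    · rintro ⟨x, -, rfl⟩
      obtain ⟨β, rfl⟩ := QuotientAddGroup.mk_surjective x
      rw [hFmk]
      by_cases hβ : Valued.v (β : K) ≤ 1
      · left
        rw [hF1, ZeroMemClass.coe_zero, zero_sub, Valuation.map_neg]
        exact hβ
      · right
        exact (hF2 β).2 hβ
    · rintro (rfl | hα)
      · exact ⟨((0 : L1) : L1 ⧸ L0'), Finset.mem_univ _, hFmk 0⟩
      · obtain ⟨β, hβ⟩ := hF3 α hα
        exact ⟨(β : L1 ⧸ L0'), Finset.mem_univ _, by rw [hFmk, hβ]⟩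
  have hcard : (Finset.univ.image F).card = Nat.card 𝓀[K] := by
    rw [Finset.card_image_of_injective _ hFinj, Finset.card_univ, ← Nat.card_eq_fintype_card, ← AddSubgroup.index_eq_card]
    exact hidx
  rw [himage, Finset.card_insert_of_notMem hnot] at hcard
  omega

variable [Finite 𝓀[K]] [IsHeckeTriple (⊤ : Submonoid (symplecticGroup (Fin 1) K)) (symplecticInt (Fin 1) K) (symplecticInt (Fin 1) K)]
include hϖ

omit [Valued K ℤᵐ⁰] [Finite 𝓀[K]] [IsHeckeTriple (⊤ : Submonoid (symplecticGroup (Fin 1) K)) (symplecticInt (Fin 1) K) (symplecticInt (Fin 1) K)] hϖ in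
/-- Constant exponents are injective in the constant. [folklore] -/
private theorem const_fin_one_inj {a b : ℤ} : ((fun _ : Fin 1 => a) = fun _ : Fin 1 => b) ↔ a = b :=
  ⟨fun h => congrFun h 0, fun h => by rw [h]⟩

omit [Finite 𝓀[K]] in
/-- **The top coefficient**: `𝒮_q(1_{K₀tK₀})_1 = q` (one coset `tK₀` of exponent `1`, weight `q`). [cite: CartierCorvallis1979, §IV (4.2)]
[cite: BruhatTits1972, (4.4.4) (ii)] -/
theorem coeff_symplecticSatakeTransform_basic_one (q : Rˣ) :
    (symplecticSatakeTransform hϖ q (heckeAlgebra.doubleCosetOperator (symplecticInt (Fin 1) K)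
        (⟨Matrix.diagonal (Sum.elim (fun _ : Fin 1 => ϖ ^ (1 : ℕ)) (fun _ : Fin 1 => (ϖ ^ (1 : ℕ))⁻¹)),
            diagonal_pow_mem_symplecticGroup (uniformizer_ne_zero hϖ) (fun _ : Fin 1 => 1)⟩ : symplecticGroup (Fin 1) K))).coeff
        (fun _ : Fin 1 => (1 : ℤ)) = (q : R) := by
  classical
  have h1 := coeff_satakeTransform_one_cartan_self hϖ (R := R) 1
  simp only [Nat.cast_one] at h1
  rw [(isIwasawaExponent_symplectic (n := 1) hϖ).coeff_satakeTransform_doubleCosetOperator, MonoidHom.one_apply, mul_one] at h1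
  rw [coeff_symplecticSatakeTransform_doubleCosetOperator, h1, one_mul, symplecticRhoPairing_one, zpow_one]

/-- **The bottom coefficient**: `𝒮_q(1_{K₀tK₀})_{-1} = q` (by `W`-symmetry; directly: `q²` cosets of exponent `-1`, weight `q⁻¹`),
for `q` the residue cardinality. [cite: CartierCorvallis1979, §IV (4.2), Thm. 4.1] [cite: Macdonald1995, Ch. V (3.4)] -/
theorem coeff_symplecticSatakeTransform_basic_neg_one (q : Rˣ) (hq : (q : R) = Nat.card 𝓀[K]) :
    (symplecticSatakeTransform hϖ q (heckeAlgebra.doubleCosetOperator (symplecticInt (Fin 1) K)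
        (⟨Matrix.diagonal (Sum.elim (fun _ : Fin 1 => ϖ ^ (1 : ℕ)) (fun _ : Fin 1 => (ϖ ^ (1 : ℕ))⁻¹)),
            diagonal_pow_mem_symplecticGroup (uniformizer_ne_zero hϖ) (fun _ : Fin 1 => 1)⟩ : symplecticGroup (Fin 1) K))).coeff
        (fun _ : Fin 1 => (-1 : ℤ)) = (q : R) := by
  rw [show (fun _ : Fin 1 => (-1 : ℤ)) = -fun _ : Fin 1 => (1 : ℤ) from funext fun _ => by simp,
    coeff_symplecticSatakeTransform_neg_rank_one hϖ q hq, coeff_symplecticSatakeTransform_basic_one hϖ]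

/-- **The middle coefficient**: `𝒮_q(1_{K₀tK₀})_0 = q - 1` for `q` the residue cardinality. [cite: CartierCorvallis1979, §IV (4.2)]
[cite: Macdonald1995, Ch. V (2.6)] -/
theorem coeff_symplecticSatakeTransform_basic_zero (q : Rˣ) (hq : (q : R) = Nat.card 𝓀[K]) :
    (symplecticSatakeTransform hϖ q (heckeAlgebra.doubleCosetOperator (symplecticInt (Fin 1) K)
        (⟨Matrix.diagonal (Sum.elim (fun _ : Fin 1 => ϖ ^ (1 : ℕ)) (fun _ : Fin 1 => (ϖ ^ (1 : ℕ))⁻¹)),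
            diagonal_pow_mem_symplecticGroup (uniformizer_ne_zero hϖ) (fun _ : Fin 1 => 1)⟩ : symplecticGroup (Fin 1) K))).coeff 0 =
      (q : R) - 1 := by
  classical
  have h1 : 1 ≤ Nat.card 𝓀[K] := Nat.card_pos
  rw [coeff_symplecticSatakeTransform_doubleCosetOperator, card_filter_symplecticIwasawaExp_basic_zero hϖ, symplecticRhoPairing_zero,
    zpow_zero, Units.val_one, mul_one, Nat.cast_sub h1, Nat.cast_one, hq]

/-- **The support**: `𝒮_q(1_{K₀tK₀})_m = 0` for `m ∉ {-1, 0, 1}` (dominance `m ≤ 1` and `W`-symmetry). [cite: CartierCorvallis1979, §IV (4.2)]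
[cite: BruhatTits1972, (4.4.4) (i)] -/
theorem coeff_symplecticSatakeTransform_basic_eq_zero (q : Rˣ) (hq : (q : R) = Nat.card 𝓀[K]) {m : ℤ} (hm : m ≠ -1 ∧ m ≠ 0 ∧ m ≠ 1) :
    (symplecticSatakeTransform hϖ q (heckeAlgebra.doubleCosetOperator (symplecticInt (Fin 1) K)
        (⟨Matrix.diagonal (Sum.elim (fun _ : Fin 1 => ϖ ^ (1 : ℕ)) (fun _ : Fin 1 => (ϖ ^ (1 : ℕ))⁻¹)),
            diagonal_pow_mem_symplecticGroup (uniformizer_ne_zero hϖ) (fun _ : Fin 1 => 1)⟩ : symplecticGroup (Fin 1) K))).coeff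
        (fun _ : Fin 1 => m) = 0 := by
  classical
  -- above the top: `𝒮_1`-coefficient `0`, hence the count vanishes in `R`
  have htop : ∀ n : ℤ, 1 < n → (symplecticSatakeTransform hϖ q (heckeAlgebra.doubleCosetOperator (symplecticInt (Fin 1) K)
      (⟨Matrix.diagonal (Sum.elim (fun _ : Fin 1 => ϖ ^ (1 : ℕ)) (fun _ : Fin 1 => (ϖ ^ (1 : ℕ))⁻¹)),
          diagonal_pow_mem_symplecticGroup (uniformizer_ne_zero hϖ) (fun _ : Fin 1 => 1)⟩ : symplecticGroup (Fin 1) K))).coeff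
        (fun _ : Fin 1 => n) = 0 := fun n hn => by
    have h0 := coeff_satakeTransform_one_cartan_eq_zero_of_lt hϖ (R := R) 1 (μ := fun _ : Fin 1 => n) (by exact_mod_cast hn)
    rw [(isIwasawaExponent_symplectic (n := 1) hϖ).coeff_satakeTransform_doubleCosetOperator, MonoidHom.one_apply, mul_one] at h0
    rw [coeff_symplecticSatakeTransform_doubleCosetOperator, h0, zero_mul]
  rcases lt_or_gt_of_ne hm.2.2 with hlt | hgt
  · -- `m ≤ -2`: symmetry
    rw [show (fun _ : Fin 1 => m) = -fun _ : Fin 1 => -m from funext fun _ => by simp, coeff_symplecticSatakeTransform_neg_rank_one hϖ q hq]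
    exact htop (-m) (by omega)
  · exact htop m hgt

omit [Valued K ℤᵐ⁰] [Finite 𝓀[K]] [IsHeckeTriple (⊤ : Submonoid (symplecticGroup (Fin 1) K)) (symplecticInt (Fin 1) K) (symplecticInt (Fin 1) K)] hϖ in
/-- Coefficients of a scalar in `R[ℤ¹]`. [folklore] -/
private theorem coeff_algebraMap_fin_one (c : R) (μ : Fin 1 → ℤ) :
    (algebraMap R (AddMonoidAlgebra R (Fin 1 → ℤ)) c).coeff μ = if (0 : Fin 1 → ℤ) = μ then c else 0 := by
  rw [Algebra.algebraMap_eq_smul_one, AddMonoidAlgebra.one_def, AddMonoidAlgebra.coeff_smul, Finsupp.smul_apply,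
    AddMonoidAlgebra.coeff_single, Finsupp.single_apply, smul_eq_mul, mul_ite, mul_one, mul_zero]

/-- **THE BASIC HECKE OPERATOR OF `SL₂(K)` EVALUATED**: for `t = diag(ϖ; ϖ⁻¹)` and `q ∈ Rˣ` the residue cardinality,
`𝒮_q(1_{K₀tK₀}) = q · (x + x⁻¹) + (q - 1) · 1` in `R[x^{±1}]` (on the `(q+1)`-regular tree: one coset above, `q - 1` level, `q²` below).
[cite: CartierCorvallis1979, §IV (4.2), Thm. 4.1] [cite: Macdonald1995, Ch. V (3.4)] [cite: Satake1963, §§6–7] -/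
theorem symplecticSatakeTransform_doubleCosetOperator_basic (q : Rˣ) (hq : (q : R) = Nat.card 𝓀[K]) :
    symplecticSatakeTransform hϖ q (heckeAlgebra.doubleCosetOperator (symplecticInt (Fin 1) K)
        (⟨Matrix.diagonal (Sum.elim (fun _ : Fin 1 => ϖ ^ (1 : ℕ)) (fun _ : Fin 1 => (ϖ ^ (1 : ℕ))⁻¹)),
            diagonal_pow_mem_symplecticGroup (uniformizer_ne_zero hϖ) (fun _ : Fin 1 => 1)⟩ : symplecticGroup (Fin 1) K)) =
      (q : R) • (AddMonoidAlgebra.single (fun _ : Fin 1 => (1 : ℤ)) (1 : R) + AddMonoidAlgebra.single (fun _ : Fin 1 => (-1 : ℤ)) 1) +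
        algebraMap R (AddMonoidAlgebra R (Fin 1 → ℤ)) ((q : R) - 1) := by
  classical
  refine AddMonoidAlgebra.ext (Finsupp.ext fun μ => ?_)
  rw [AddMonoidAlgebra.coeff_add, Finsupp.add_apply, AddMonoidAlgebra.coeff_smul, Finsupp.smul_apply, AddMonoidAlgebra.coeff_add,
    Finsupp.add_apply, AddMonoidAlgebra.coeff_single, AddMonoidAlgebra.coeff_single, Finsupp.single_apply, Finsupp.single_apply,
    coeff_algebraMap_fin_one, smul_eq_mul]
  obtain ⟨m, hm⟩ : ∃ m : ℤ, μ = fun _ : Fin 1 => m := ⟨μ 0, eq_const_of_fin_one μ⟩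
  subst hm
  rw [show (0 : Fin 1 → ℤ) = fun _ : Fin 1 => (0 : ℤ) from rfl]
  simp only [const_fin_one_inj]
  by_cases h1 : m = 1
  · subst h1
    rw [if_pos rfl, if_neg (by norm_num), if_neg (by norm_num), coeff_symplecticSatakeTransform_basic_one hϖ]; ring
  by_cases h2 : m = -1
  · subst h2
    rw [if_neg (by norm_num), if_pos rfl, if_neg (by norm_num), coeff_symplecticSatakeTransform_basic_neg_one hϖ q hq]; ring
  by_cases h3 : m = 0
  · subst h3
    rw [if_neg (by norm_num), if_neg (by norm_num), if_pos rfl, ← show (0 : Fin 1 → ℤ) = fun _ : Fin 1 => (0 : ℤ) from rfl,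
      coeff_symplecticSatakeTransform_basic_zero hϖ q hq]; ring
  · rw [if_neg (Ne.symm h1), if_neg (Ne.symm h2), if_neg (Ne.symm h3), coeff_symplecticSatakeTransform_basic_eq_zero hϖ q hq ⟨h2, h3, h1⟩]
    ring

/-! ## §4 Eigenvalues and the degree `#(K₀tK₀/K₀) = q² + q` -/

/-- **THE UNRAMIFIED EIGENVALUES OF THE BASIC OPERATOR OF `SL₂`**: `λ_{q,χ}(1_{K₀tK₀}) = q(χ(x) + χ(x⁻¹)) + q - 1`.
[cite: CartierCorvallis1979, §IV (4.2), Cor. 4.2] [cite: Macdonald1995, Ch. V (3.4)] -/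
theorem symplecticHeckeEigencharacter_doubleCosetOperator_basic (q : Rˣ) (hq : (q : R) = Nat.card 𝓀[K])
    (χ : Multiplicative (Fin 1 → ℤ) →* R) :
    symplecticHeckeEigencharacter hϖ q χ (heckeAlgebra.doubleCosetOperator (symplecticInt (Fin 1) K)
        (⟨Matrix.diagonal (Sum.elim (fun _ : Fin 1 => ϖ ^ (1 : ℕ)) (fun _ : Fin 1 => (ϖ ^ (1 : ℕ))⁻¹)),
            diagonal_pow_mem_symplecticGroup (uniformizer_ne_zero hϖ) (fun _ : Fin 1 => 1)⟩ : symplecticGroup (Fin 1) K)) =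
      (q : R) * (χ (Multiplicative.ofAdd fun _ : Fin 1 => (1 : ℤ)) + χ (Multiplicative.ofAdd fun _ : Fin 1 => (-1 : ℤ))) + ((q : R) - 1) := by
  rw [symplecticHeckeEigencharacter, IsIwasawaExponent.heckeEigencharacter_apply, ← symplecticSatakeTransform_eq,
    symplecticSatakeTransform_doubleCosetOperator_basic hϖ q hq, map_add, map_smul, AlgHom.commutes, Algebra.algebraMap_self_apply,
    map_add, AddMonoidAlgebra.lift_single, AddMonoidAlgebra.lift_single, one_smul, one_smul, smul_eq_mul]

omit [Valued K ℤᵐ⁰] [Finite 𝓀[K]] [IsHeckeTriple (⊤ : Submonoid (symplecticGroup (Fin 1) K)) (symplecticInt (Fin 1) K) (symplecticInt (Fin 1) K)] hϖ in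
/-- `w_q · w_{q⁻¹} = 1` as characters of `Λ` (any `n`). [cite: CartierCorvallis1979, §IV (4.2)] -/
theorem symplecticSatakeWeight_mul_inv_eq_one {n : ℕ} (q : Rˣ) :
    symplecticSatakeWeight (n := n) q * symplecticSatakeWeight q⁻¹ = 1 :=
  MonoidHom.ext fun l => by rw [MonoidHom.mul_apply, MonoidHom.one_apply, symplecticSatakeWeight_mul_symplecticSatakeWeight_inv]

omit [Valued K ℤᵐ⁰] [Finite 𝓀[K]] [IsHeckeTriple (⊤ : Submonoid (symplecticGroup (Fin 1) K)) (symplecticInt (Fin 1) K) (symplecticInt (Fin 1) K)] hϖ in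
/-- `w_1 = 1`. [cite: CartierCorvallis1979, §IV (4.2)] -/
theorem symplecticSatakeWeight_one {n : ℕ} : symplecticSatakeWeight (n := n) (1 : Rˣ) = 1 :=
  MonoidHom.ext fun l => by rw [← ofAdd_toAdd l, symplecticSatakeWeight_ofAdd, _root_.one_zpow, Units.val_one, MonoidHom.one_apply]

/-- **THE DEGREE OF THE BASIC HECKE OPERATOR OF `SL₂`**: `#(K₀tK₀/K₀) = q² + q` (the vertices at distance `2` in the `(q+1)`-regular
tree): the eigenvalue `λ_{q, w_q⁻¹}(1_{K₀tK₀}) = λ_{1,1}(1_{K₀tK₀}) = deg`, evaluated at `χ(x) = q⁻¹` over `ℚ`.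
[cite: CartierCorvallis1979, §IV (4.2)–(4.4)] [cite: Serre1979, Ch. II §3] -/
theorem card_orbit_basic_symplectic :
    (finite_orbit_quotient (symplecticInt (Fin 1) K)
        (⟨Matrix.diagonal (Sum.elim (fun _ : Fin 1 => ϖ ^ (1 : ℕ)) (fun _ : Fin 1 => (ϖ ^ (1 : ℕ))⁻¹)),
            diagonal_pow_mem_symplecticGroup (uniformizer_ne_zero hϖ) (fun _ : Fin 1 => 1)⟩ : symplecticGroup (Fin 1) K)).toFinset.card =
      Nat.card 𝓀[K] ^ 2 + Nat.card 𝓀[K] := by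
  have hQ : (Nat.card 𝓀[K] : ℚ) ≠ 0 := Nat.cast_ne_zero.2 Nat.card_pos.ne'
  set q₀ : ℚˣ := Units.mk0 (Nat.card 𝓀[K] : ℚ) hQ with hq₀
  have hq : (q₀ : ℚ) = Nat.card 𝓀[K] := rfl
  -- `deg = λ_{1,1} = λ_{q, w_q⁻¹}`
  have hdeg := symplecticHeckeEigencharacter_one_one_doubleCosetOperator (R := ℚ) hϖ
    (⟨Matrix.diagonal (Sum.elim (fun _ : Fin 1 => ϖ ^ (1 : ℕ)) (fun _ : Fin 1 => (ϖ ^ (1 : ℕ))⁻¹)),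
        diagonal_pow_mem_symplecticGroup (uniformizer_ne_zero hϖ) (fun _ : Fin 1 => 1)⟩ : symplecticGroup (Fin 1) K)
  have hsw : symplecticHeckeEigencharacter (n := 1) (R := ℚ) hϖ 1 1 = symplecticHeckeEigencharacter hϖ q₀ (symplecticSatakeWeight q₀⁻¹) := by
    rw [symplecticHeckeEigencharacter_eq_one_mul, symplecticHeckeEigencharacter_eq_one_mul, symplecticSatakeWeight_one, one_mul,
      symplecticSatakeWeight_mul_inv_eq_one]
  rw [hsw, symplecticHeckeEigencharacter_doubleCosetOperator_basic hϖ q₀ hq, symplecticSatakeWeight_ofAdd, symplecticSatakeWeight_ofAdd,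
    symplecticRhoPairing_one, symplecticRhoPairing_one, zpow_one, _root_.zpow_neg, zpow_one, inv_inv] at hdeg
  have h' : ((finite_orbit_quotient (symplecticInt (Fin 1) K)
      (⟨Matrix.diagonal (Sum.elim (fun _ : Fin 1 => ϖ ^ (1 : ℕ)) (fun _ : Fin 1 => (ϖ ^ (1 : ℕ))⁻¹)),
          diagonal_pow_mem_symplecticGroup (uniformizer_ne_zero hϖ) (fun _ : Fin 1 => 1)⟩ : symplecticGroup (Fin 1) K)).toFinset.card : ℚ) =
      (Nat.card 𝓀[K] : ℚ) ^ 2 + Nat.card 𝓀[K] := by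
    rw [← hdeg, Units.val_inv_eq_inv_val, hq]
    field_simp
    ring
  exact_mod_cast h'

/-! ## §5 `ℋ(SL₂(K), SL₂(𝒪); R) = R[1_{K₀tK₀}]`: symmetric Laurent polynomials are polynomials in `x + x⁻¹` -/

omit [Valued K ℤᵐ⁰] [Finite 𝓀[K]] [IsHeckeTriple (⊤ : Submonoid (symplecticGroup (Fin 1) K)) (symplecticInt (Fin 1) K) (symplecticInt (Fin 1) K)] hϖ in
/-- **`R[x^{±1}]^{W} = R[x + x⁻¹]`**: every `g ∈ R[ℤ¹]` with `g_{-m} = g_m` is a polynomial in `X = x + x⁻¹` (induction on the top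
exponent, subtracting `g_n · (x^n + x^{-n}) = g_n · Q_n(X)`; the line `ℓ_m = (m)` of rank one).
[cite: CartierCorvallis1979, §IV Thm. 4.1] [cite: Macdonald1995, Ch. V (3.4)] -/
theorem exists_aeval_eq_of_symmetric_fin_one (g : AddMonoidAlgebra R (Fin 1 → ℤ)) (hg : ∀ μ : Fin 1 → ℤ, g.coeff (-μ) = g.coeff μ) :
    ∃ P : R[X], aeval (AddMonoidAlgebra.single (fun _ : Fin 1 => (1 : ℤ)) (1 : R) + AddMonoidAlgebra.single (fun _ : Fin 1 => (-1 : ℤ)) 1) P = g := by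
  classical
  -- the line `ℓ_m = (m)` is additive
  have hadd : ∀ a b : ℤ, (fun m : ℤ => fun _ : Fin 1 => m) (a + b) = (fun m : ℤ => fun _ : Fin 1 => m) a + (fun m : ℤ => fun _ : Fin 1 => m) b :=
    fun a b => rfl
  suffices key : ∀ (n : ℕ) (g : AddMonoidAlgebra R (Fin 1 → ℤ)), (∀ μ : Fin 1 → ℤ, g.coeff (-μ) = g.coeff μ) →
      (∀ μ : Fin 1 → ℤ, (n : ℤ) < μ 0 → g.coeff μ = 0) →
      ∃ P : R[X], aeval (AddMonoidAlgebra.single (fun _ : Fin 1 => (1 : ℤ)) (1 : R) + AddMonoidAlgebra.single (fun _ : Fin 1 => (-1 : ℤ)) 1) P = g by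
    refine key (g.coeff.support.sup fun μ => (μ 0).toNat) g hg fun μ hμ => ?_
    by_contra hne
    have hmem : μ ∈ g.coeff.support := Finsupp.mem_support_iff.2 hne
    have hle : (μ 0).toNat ≤ g.coeff.support.sup fun μ => (μ 0).toNat := Finset.le_sup (f := fun μ => (μ 0).toNat) hmem
    have := Int.self_le_toNat (μ 0)
    omega
  intro n
  induction n with
  | zero =>
    intro g hg hsupp
    refine ⟨C (g.coeff 0), ?_⟩
    rw [aeval_C]
    refine AddMonoidAlgebra.ext (Finsupp.ext fun μ => ?_)
    rw [coeff_algebraMap_fin_one]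
    by_cases hμ0 : (0 : Fin 1 → ℤ) = μ
    · rw [if_pos hμ0, hμ0]
    · rw [if_neg hμ0]
      have hμ : μ 0 ≠ 0 := fun h => hμ0 (by rw [eq_const_of_fin_one μ, h]; rfl)
      rcases lt_or_gt_of_ne hμ with hlt | hgt
      · rw [← hg μ, hsupp (-μ) (by rw [Pi.neg_apply, Nat.cast_zero]; omega)]
      · rw [hsupp μ (by rw [Nat.cast_zero]; exact hgt)]
  | succ n ih =>
    intro g hg hsupp
    set c : R := g.coeff (fun _ : Fin 1 => (n : ℤ) + 1) with hc
    set p : AddMonoidAlgebra R (Fin 1 → ℤ) :=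
      AddMonoidAlgebra.single (fun _ : Fin 1 => (n : ℤ) + 1) 1 + AddMonoidAlgebra.single (fun _ : Fin 1 => -((n : ℤ) + 1)) 1 with hp
    have hpcoeff : ∀ μ : Fin 1 → ℤ, p.coeff μ =
        (if (fun _ : Fin 1 => (n : ℤ) + 1) = μ then 1 else 0) + (if (fun _ : Fin 1 => -((n : ℤ) + 1)) = μ then 1 else 0) := fun μ => by
      rw [hp, AddMonoidAlgebra.coeff_add, Finsupp.add_apply, AddMonoidAlgebra.coeff_single, AddMonoidAlgebra.coeff_single,
        Finsupp.single_apply, Finsupp.single_apply]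
    have hgc : ∀ μ : Fin 1 → ℤ, (g - c • p).coeff μ = g.coeff μ - c * p.coeff μ := fun μ => by
      rw [AddMonoidAlgebra.coeff_sub, Finsupp.sub_apply, AddMonoidAlgebra.coeff_smul, Finsupp.smul_apply, smul_eq_mul]
    have hne : ∀ (a : ℤ) (μ : Fin 1 → ℤ), μ 0 ≠ a → (fun _ : Fin 1 => a) ≠ μ := fun a μ h e => h (by rw [← e])
    obtain ⟨P', hP'⟩ := ih (g - c • p)
      (fun μ => by
        rw [hgc, hgc, hpcoeff, hpcoeff, hg μ]
        congr 2
        rw [add_comm]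
        congr 1
        · refine if_congr ⟨fun h => ?_, fun h => ?_⟩ rfl rfl
          · rw [← neg_neg μ, ← h]; funext; simp
          · rw [← h]; funext; simp
        · refine if_congr ⟨fun h => ?_, fun h => ?_⟩ rfl rfl
          · rw [← neg_neg μ, ← h]; funext; simp
          · rw [← h]; funext; simp)
      (fun μ hμ => by
        rw [hgc, hpcoeff]
        rcases lt_or_eq_of_le (show (n : ℤ) + 1 ≤ μ 0 by omega) with hlt | heq
        · rw [hsupp μ (by push_cast; exact hlt), if_neg (hne _ μ (by omega)), if_neg (hne _ μ (by omega)), add_zero, mul_zero, sub_zero]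
        · have hμ' : μ = fun _ : Fin 1 => (n : ℤ) + 1 := by rw [eq_const_of_fin_one μ, heq]
          rw [if_pos hμ'.symm, if_neg (hne _ μ (by omega)), add_zero, mul_one, hμ', ← hc, sub_self])
    obtain ⟨Q, hQ⟩ := exists_aeval_eq_p (R := R) (ℓ := fun m : ℤ => fun _ : Fin 1 => m) hadd (n + 1)
    refine ⟨P' + C c * Q, ?_⟩
    rw [map_add, map_mul, aeval_C, hP', hQ, ← Algebra.smul_def, Nat.cast_succ, ← hp, sub_add_cancel]

/-- **A generator of `ℋ(SL₂(K), SL₂(𝒪); R)`**: for `q ∈ Rˣ` the residue cardinality there is `T₁ ∈ ℋ` with `𝒮_q(T₁) = x + x⁻¹`, and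
every `T ∈ ℋ` is a polynomial in `T₁` (`range 𝒮_q = R[x^{±1}]^W = R[x + x⁻¹]`, `𝒮_q` injective: g45-#2).
[cite: CartierCorvallis1979, §IV Thm. 4.1] [cite: Satake1963, §§6–7] [cite: Macdonald1995, Ch. V (3.4)] -/
theorem exists_generator_symplectic_rank_one (q : Rˣ) (hq : (q : R) = Nat.card 𝓀[K]) :
    ∃ T₁ : heckeAlgebra R (symplecticGroup (Fin 1) K) (symplecticInt (Fin 1) K),
      symplecticSatakeTransform hϖ q T₁ =
          AddMonoidAlgebra.single (fun _ : Fin 1 => (1 : ℤ)) (1 : R) + AddMonoidAlgebra.single (fun _ : Fin 1 => (-1 : ℤ)) 1 ∧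
        ∀ T, ∃ P : R[X], aeval T₁ P = T := by
  have hrange := range_symplecticSatakeTransform_rank_one hϖ q hq
  have hX : AddMonoidAlgebra.single (fun _ : Fin 1 => (1 : ℤ)) (1 : R) + AddMonoidAlgebra.single (fun _ : Fin 1 => (-1 : ℤ)) 1 ∈
      Set.range (symplecticSatakeTransform (n := 1) (R := R) hϖ q) := by
    rw [hrange]
    intro μ
    classical
    simp only [AddMonoidAlgebra.coeff_add, Finsupp.add_apply, AddMonoidAlgebra.coeff_single, Finsupp.single_apply]
    obtain ⟨m, hm⟩ : ∃ m : ℤ, μ = fun _ : Fin 1 => m := ⟨μ 0, eq_const_of_fin_one μ⟩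
    subst hm
    rw [show -(fun _ : Fin 1 => m) = fun _ : Fin 1 => -m from funext fun _ => rfl]
    simp only [const_fin_one_inj]
    rw [add_comm]
    congr 1
    · exact if_congr (by omega) rfl rfl
    · exact if_congr (by omega) rfl rfl
  obtain ⟨T₁, hT₁⟩ := hX
  refine ⟨T₁, hT₁, fun T => ?_⟩
  have hT : symplecticSatakeTransform hϖ q T ∈ Set.range (symplecticSatakeTransform (n := 1) (R := R) hϖ q) := ⟨T, rfl⟩
  rw [hrange] at hT
  obtain ⟨P, hP⟩ := exists_aeval_eq_of_symmetric_fin_one (symplecticSatakeTransform hϖ q T) hT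
  refine ⟨P, symplecticSatakeTransform_injective_of_commRing hϖ q ?_⟩
  rw [← aeval_algHom_apply, hT₁, hP]

set_option synthInstance.maxHeartbeats 200000 in
/-- **`1_{K₀tK₀} = q · T₁ + (q - 1)`** for the generator `T₁` (`𝒮_q(T₁) = x + x⁻¹`). [cite: CartierCorvallis1979, §IV Thm. 4.1] -/
theorem doubleCosetOperator_basic_eq_symplectic (q : Rˣ) (hq : (q : R) = Nat.card 𝓀[K])
    {T₁ : heckeAlgebra R (symplecticGroup (Fin 1) K) (symplecticInt (Fin 1) K)}
    (hT₁ : symplecticSatakeTransform hϖ q T₁ =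
      AddMonoidAlgebra.single (fun _ : Fin 1 => (1 : ℤ)) (1 : R) + AddMonoidAlgebra.single (fun _ : Fin 1 => (-1 : ℤ)) 1) :
    heckeAlgebra.doubleCosetOperator (symplecticInt (Fin 1) K)
        (⟨Matrix.diagonal (Sum.elim (fun _ : Fin 1 => ϖ ^ (1 : ℕ)) (fun _ : Fin 1 => (ϖ ^ (1 : ℕ))⁻¹)),
            diagonal_pow_mem_symplecticGroup (uniformizer_ne_zero hϖ) (fun _ : Fin 1 => 1)⟩ : symplecticGroup (Fin 1) K) =
      (q : R) • T₁ + algebraMap R _ ((q : R) - 1) :=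
  symplecticSatakeTransform_injective_of_commRing hϖ q (by
    rw [symplecticSatakeTransform_doubleCosetOperator_basic hϖ q hq, Algebra.smul_def, Algebra.smul_def]
    simp only [map_add, map_mul, AlgHom.commutes, hT₁])

/-- **`ℋ(SL₂(K), SL₂(𝒪); R) = R[1_{K₀tK₀}]`** for `q ∈ Rˣ` the residue cardinality: every Hecke operator is a polynomial in the basic
one (`T₁ = q⁻¹(1_{K₀tK₀} - (q - 1))`). [cite: CartierCorvallis1979, §IV Thm. 4.1, Cor. 4.2] [cite: Satake1963, §§6–7] -/
theorem exists_aeval_doubleCosetOperator_basic_symplectic (q : Rˣ) (hq : (q : R) = Nat.card 𝓀[K])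
    (T : heckeAlgebra R (symplecticGroup (Fin 1) K) (symplecticInt (Fin 1) K)) :
    ∃ P : R[X], aeval (heckeAlgebra.doubleCosetOperator (k := R) (symplecticInt (Fin 1) K)
        (⟨Matrix.diagonal (Sum.elim (fun _ : Fin 1 => ϖ ^ (1 : ℕ)) (fun _ : Fin 1 => (ϖ ^ (1 : ℕ))⁻¹)),
            diagonal_pow_mem_symplecticGroup (uniformizer_ne_zero hϖ) (fun _ : Fin 1 => 1)⟩ : symplecticGroup (Fin 1) K)) P = T := by
  obtain ⟨T₁, hT₁, hgen⟩ := exists_generator_symplectic_rank_one hϖ q hq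
  have hc := doubleCosetOperator_basic_eq_symplectic hϖ q hq hT₁
  set c := heckeAlgebra.doubleCosetOperator (k := R) (symplecticInt (Fin 1) K)
    (⟨Matrix.diagonal (Sum.elim (fun _ : Fin 1 => ϖ ^ (1 : ℕ)) (fun _ : Fin 1 => (ϖ ^ (1 : ℕ))⁻¹)),
        diagonal_pow_mem_symplecticGroup (uniformizer_ne_zero hϖ) (fun _ : Fin 1 => 1)⟩ : symplecticGroup (Fin 1) K) with hcdef
  have h2 : aeval c (X - C ((q : R) - 1)) = (q : R) • T₁ := by
    rw [map_sub, aeval_X, aeval_C]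
    exact sub_eq_of_eq_add hc
  have hT₁c : T₁ = aeval c (C ((q⁻¹ : Rˣ) : R) * (X - C ((q : R) - 1))) := by
    rw [map_mul, aeval_C, h2, Algebra.algebraMap_eq_smul_one, smul_mul_assoc, one_mul, smul_smul, Units.inv_mul, one_smul]
  obtain ⟨P, hP⟩ := hgen T
  exact ⟨P.comp (C ((q⁻¹ : Rˣ) : R) * (X - C ((q : R) - 1))), by rw [aeval_comp, ← hT₁c, hP]⟩

/-- **An algebra homomorphism `ℋ(SL₂(K), SL₂(𝒪); R) → B` is determined by its value on the basic Hecke operator.**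
[cite: CartierCorvallis1979, §IV Cor. 4.2] -/
theorem algHom_ext_doubleCosetOperator_basic_symplectic (q : Rˣ) (hq : (q : R) = Nat.card 𝓀[K]) {B : Type*} [Semiring B] [Algebra R B]
    {χ χ' : heckeAlgebra R (symplecticGroup (Fin 1) K) (symplecticInt (Fin 1) K) →ₐ[R] B}
    (h : χ (heckeAlgebra.doubleCosetOperator (symplecticInt (Fin 1) K)
        (⟨Matrix.diagonal (Sum.elim (fun _ : Fin 1 => ϖ ^ (1 : ℕ)) (fun _ : Fin 1 => (ϖ ^ (1 : ℕ))⁻¹)),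
            diagonal_pow_mem_symplecticGroup (uniformizer_ne_zero hϖ) (fun _ : Fin 1 => 1)⟩ : symplecticGroup (Fin 1) K)) =
      χ' (heckeAlgebra.doubleCosetOperator (symplecticInt (Fin 1) K)
        (⟨Matrix.diagonal (Sum.elim (fun _ : Fin 1 => ϖ ^ (1 : ℕ)) (fun _ : Fin 1 => (ϖ ^ (1 : ℕ))⁻¹)),
            diagonal_pow_mem_symplecticGroup (uniformizer_ne_zero hϖ) (fun _ : Fin 1 => 1)⟩ : symplecticGroup (Fin 1) K))) :
    χ = χ' := by
  refine AlgHom.ext fun T => ?_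
  obtain ⟨P, rfl⟩ := exists_aeval_doubleCosetOperator_basic_symplectic hϖ q hq T
  rw [← aeval_algHom_apply, ← aeval_algHom_apply, h]

end RankOne

end Literature.NumberTheory.Automorphic.SymplecticCartan

end
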